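import Summits.BirchSwinnertonDyer.BirchSwinnertonDyer.Theorems.Rank1ResidualX1Converse
import Literature.NumberTheory.EllipticCurves.Rank1Residual.X1RankOne

/-!
# Rank-≤1 BSD residual class X1 ∩ {r = 1}, `p ≥ 5`: the typed MISSING INPUT and the typed TARGET
# coincide modulo the Schneider certificate; the parity sub-class B1 is closed modulo that certificate

HONEST FRAMING (cell `b2b-bsdres`, home `run/shared/lean/b2b/bsd-rank1-residual/`, unit
`b2b-bsdres-x1b`, prover B = the independent patchwork, no Keller–Yin input, GEN 3). The goal is to
DELETE the COMBINATION-SHAPED residual classes for ALL analytic-rank `≤ 1` curves over `ℚ` — "full BSD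
formula for every rank `≤ 1` curve in class C" assembled STRICTLY from published theorems — so that the
rank-`≤ 1` remainder becomes exactly the CONSTRUCTION-SHAPED classes, which are TYPED (missing-input
`Prop`s), NOT attempted; this is not "finishing BSD". Helper file of the crux `PAdicOrderMainConjectureR5`
(stmt-BirchSwinnertonDyer-15418), companion of prover A's `Rank1ResidualX1Defs` and of
`Rank1ResidualX1Converse` (gen 2: on X1 ∩ {r = 0}, `MazurMainConjecture W p ↔ BSDp W p`).

Theorems only, in prover A's vocabulary (`MazurMainConjecture W p`, `BSDpOnClassX1`,
`MazurMainConjectureOnX1TypeA`), from the Literature files `Wuthrich2014/RankOneEngineProofs.lean`,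
`Wuthrich2014/RankOneConverseProofs.lean`, `Rank1Residual/X1RankOne.lean` (prover B, gen 3: at a reducible
good ordinary `p ≥ 5` with `ord_{s=1} L(E,s) = 1`, Wuthrich's integral divisibility + Perrin-Riou–Schneider
+ Perrin-Riou's `p`-adic Gross–Zagier comparison give `ord_p #Ш ≤ ord_p #Ш_an`, with equality iff the
Kato–Wuthrich cofactor is a unit iff Mazur's main conjecture — MODULO the per-curve certificate
"Schneider's non-degeneracy of the canonical `p`-adic height", ⟺ `[T¹]L_p(E,T) ≠ 0`):

* `mazurMainConjecture_iff_bsdp_of_analyticRank_eq_one` — at every X1 pair with `p ≥ 5` and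
  `ord_{s=1} L(E,s) = 1`, modulo the certificate: `MazurMainConjecture W p ↔ BSDp W p`, granted the
  PUBLISHED named facts Wuthrich 2014 Thm. 16, Perrin-Riou–Schneider (BMS 2016 Thm. 1.7), Perrin-Riou 1987
  §1.4, modularity, Gross–Zagier–Kolyvagin;
* `mazurMainConjecture_iff_missingInputAt_of_analyticRank_eq_one` — the same with prover B's typed
  residual `Typed.X1.MissingInputAt W p` on the right;
* B1 (= X1 ∧ {r = 1} ∧ gvpar, prover A's "type B") at `p ≥ 5` ⇒ `BSDp W p` modulo the certificate is
  the Literature theorem `Rank1Residual.X1.bsdp_of_gvPar_of_rank_one` (not restated here), from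
  Greenberg–Vatsal 2000 Thm. 1.3 (main conjecture under (GV), PUBLISHED; = `mazurMainConjecture_of_gvPar`
  below) + Perrin-Riou–Schneider + Perrin-Riou + GZK. Compare prover A's
  `bsdp_of_classX1_of_analyticRank_eq_one`, whose inputs for the same pairs are the Keller–Yin PREPRINT
  display (`thm421_rankOne_display_OPEN`) and the partner input (for type B: Mazur's main conjecture for
  the type-A twist, `MazurMainConjectureOnX1TypeA`, unstated in print). The present route needs neither;
  its one non-published input is the per-curve certificate (Schneider 1985's conjecture at `(E,p)`);
* `mazurMainConjecture_of_bsdpOnClassX1_of_analyticRank_eq_one` — the typed TARGET implies the typed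
  INPUT on `r_an = 1`, `p ≥ 5`, modulo the certificate (as on `r_an = 0`, gen 2);
* `mazurMainConjecture_and_bsdp_of_shaAn_unit_of_analyticRank_eq_one` — per pair: `p ∤ #Ш(E/ℚ)_an`
  (all 259 rank-one X1 census pairs, `N < 10⁴`) + certificate ⇒ BOTH `MazurMainConjecture W p` and
  `BSDp W p`; at the 24 census pairs with `p ≥ 5` the lane's lever is thus a `p`-adic `L`-series
  computation.

References: [Wuthrich2014] Thm. 16, §6; [PerrinRiou1987] §1.4 Cor. 1.8; [BalakrishnanMullerStein2015]
Thm. 1.7; [GreenbergVatsal2000] Thm. (1.3); [SteinWuthrich2013] §§3–4, §9; [KellerYin2024] Thm. 4.2.1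
(for comparison only; not an input); [Miller2011LMS] Def. 1.1.
-/

noncomputable section

open scoped Classical MatrixGroups ModularForm

open CongruenceSubgroup WeierstrassCurve Literature.NumberTheory.EllipticCurves
  Literature.NumberTheory.EllipticCurves.ModularForms Literature.NumberTheory.EllipticCurves.Rank1Residual
  Literature.NumberTheory.EllipticCurves.Rank1Residual.Typed
  Summit.BirchSwinnertonDyer.BirchSwinnertonDyer.Theorems.Rank1ResidualX1Defs

set_option linter.dupNamespace false
set_option autoImplicit false

namespace Summit.BirchSwinnertonDyer.BirchSwinnertonDyer.Theorems.Rank1ResidualX1RankOne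

/-- **X1 ∩ {r = 1}, `p ≥ 5`: the typed missing input IS the typed target, pair by pair, modulo the
Schneider certificate.** For `W/ℚ` globally minimal elliptic, `p ≥ 5` prime with `ClassX1 W p`,
`ord_{s=1} L(E,s) = 1`, and Schneider's non-degeneracy of the canonical `p`-adic height (`hSch`), granted
the PUBLISHED named facts Wuthrich 2014 Thm. 16 (`hW16`), Perrin-Riou–Schneider (`hS`), Perrin-Riou 1987
(`hPR`), modularity with an integral Manin constant (`hmod`) and Gross–Zagier–Kolyvagin (`hGZK`):
`MazurMainConjecture W p ↔ BSDp W p`. [cite: Wuthrich2014, Thm. 16 (p. 393) and §6 (p. 400)]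
[cite: PerrinRiou1987, §1.4 Cor. 1.8] [cite: BalakrishnanMullerStein2015, Thm. 1.7] -/
theorem mazurMainConjecture_iff_bsdp_of_analyticRank_eq_one
    (hW16 : Wuthrich2014.charIdeal_dvd_padicLFunction) (hS : Schneider1985_order_charGenerator)
    (hPR : perrinRiou_rankOne_leadingTerms) (hmod : nonempty_modularParametrizationData)
    (hGZK : rank_eq_analyticRank_of_analyticRank_le_one)
    (W : WeierstrassCurve ℚ) [W.IsElliptic] [W.IsGloballyMinimal] (p : ℕ) [Fact p.Prime]
    (hX1 : ClassX1 W p) (hp : 5 ≤ p) (hr1 : W.analyticRank = 1)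
    (hSch : ∀ Dh : PAdicHeightData W p, Dh.IsCanonical → SchneiderConjecture Dh) :
    MazurMainConjecture W p ↔ BSDp W p :=
  X1.mainConjecture_iff_bsdp_of_rank_one hW16 hS hPR hmod hGZK W p hX1 hp hr1 hSch

/-- **X1 ∩ {r = 1}, `p ≥ 5`: prover A's typed input ⟺ prover B's typed residual**
(`Typed.X1.MissingInputAt`, rank-one clause `ord_p #Ш_an = ord_p #Ш`), modulo the certificate, same
facts. [cite: Wuthrich2014, Thm. 16 and §6] [cite: PerrinRiou1987, §1.4 Cor. 1.8] -/
theorem mazurMainConjecture_iff_missingInputAt_of_analyticRank_eq_one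
    (hW16 : Wuthrich2014.charIdeal_dvd_padicLFunction) (hS : Schneider1985_order_charGenerator)
    (hPR : perrinRiou_rankOne_leadingTerms) (hmod : nonempty_modularParametrizationData)
    (hGZK : rank_eq_analyticRank_of_analyticRank_le_one)
    (W : WeierstrassCurve ℚ) [W.IsElliptic] [W.IsGloballyMinimal] (p : ℕ) [Fact p.Prime]
    (hX1 : ClassX1 W p) (hp : 5 ≤ p) (hr1 : W.analyticRank = 1)
    (hSch : ∀ Dh : PAdicHeightData W p, Dh.IsCanonical → SchneiderConjecture Dh) :
    MazurMainConjecture W p ↔ X1.MissingInputAt W p :=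
  X1.mainConjecture_iff_missingInputAt_of_rank_one hW16 hS hPR hmod hGZK W p hX1 hp hr1 hSch

/-- **Greenberg–Vatsal's theorem is an instance of the typed input**: at a good ordinary odd `p` with
`GVPar W p`, `MazurMainConjecture W p` holds (the named fact `thm13_charIdeal_eq_of_gvPar` has exactly
this body). Bookkeeping, recorded for the class-level reading of B1. [cite: GreenbergVatsal2000, Thm. (1.3)] -/
theorem mazurMainConjecture_of_gvPar (hGV : GreenbergVatsal2000.thm13_charIdeal_eq_of_gvPar)
    (W : WeierstrassCurve ℚ) [W.IsElliptic] [W.IsGloballyMinimal] (p : ℕ) [Fact p.Prime]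
    (hp : p ≠ 2) (hgood : W.HasGoodReductionAtPrime p) (hord : ¬ (p : ℤ) ∣ W.frobeniusTrace p)
    (hB : GVPar W p) : MazurMainConjecture W p :=
  hGV W p hp hgood hord hB

/-- **The typed TARGET implies the typed INPUT on `r_an = 1`, `p ≥ 5`** (modulo the certificate):
`BSDpOnClassX1` ⟹ `MazurMainConjecture W p` at every X1 pair with `p ≥ 5` and analytic rank `1`
satisfying the certificate (same published facts) — with `mazurMainConjecture_of_bsdpOnClassX1` (gen 2,
rank `0`) this exhausts the class at `p ≥ 5`. [cite: Wuthrich2014, Thm. 16 and §6]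
[cite: PerrinRiou1987, §1.4 Cor. 1.8] -/
theorem mazurMainConjecture_of_bsdpOnClassX1_of_analyticRank_eq_one (hT : BSDpOnClassX1)
    (hW16 : Wuthrich2014.charIdeal_dvd_padicLFunction) (hS : Schneider1985_order_charGenerator)
    (hPR : perrinRiou_rankOne_leadingTerms) (hmod : nonempty_modularParametrizationData)
    (hGZK : rank_eq_analyticRank_of_analyticRank_le_one)
    (W : WeierstrassCurve ℚ) [W.IsElliptic] [W.IsGloballyMinimal] (p : ℕ) [Fact p.Prime]
    (hX1 : ClassX1 W p) (hp : 5 ≤ p) (hr1 : W.analyticRank = 1)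
    (hSch : ∀ Dh : PAdicHeightData W p, Dh.IsCanonical → SchneiderConjecture Dh) :
    MazurMainConjecture W p :=
  (mazurMainConjecture_iff_bsdp_of_analyticRank_eq_one hW16 hS hPR hmod hGZK W p hX1 hp hr1 hSch).mpr
    (hT W p hX1 hr1.le)

/-- **Per pair: `p ∤ #Ш(E/ℚ)_an` + certificate ⟹ `MazurMainConjecture W p` AND `BSDp W p`** at an X1
pair with `p ≥ 5` and `ord_{s=1} L(E,s) = 1` (Wuthrich Thm. 16, Perrin-Riou–Schneider, Perrin-Riou,
modularity, GZK). All 259 rank-one X1 pairs of conductor `< 10⁴` have `p ∤ #Ш_an`; 24 of them are at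
`p ≥ 5` (census pointer, not a verdict). [cite: Wuthrich2014, Thm. 16 and §6]
[cite: PerrinRiou1987, §1.4 Cor. 1.8] [cite: Miller2011LMS, Def. 1.1 (arXiv:1010.2431 p. 3)] -/
theorem mazurMainConjecture_and_bsdp_of_shaAn_unit_of_analyticRank_eq_one
    (hW16 : Wuthrich2014.charIdeal_dvd_padicLFunction) (hS : Schneider1985_order_charGenerator)
    (hPR : perrinRiou_rankOne_leadingTerms) (hmod : nonempty_modularParametrizationData)
    (hGZK : rank_eq_analyticRank_of_analyticRank_le_one)
    (W : WeierstrassCurve ℚ) [W.IsElliptic] [W.IsGloballyMinimal] (p : ℕ) [Fact p.Prime]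
    (hX1 : ClassX1 W p) (hp : 5 ≤ p) (hr1 : W.analyticRank = 1)
    (hSch : ∀ Dh : PAdicHeightData W p, Dh.IsCanonical → SchneiderConjecture Dh)
    (hunit : ∃ q : ℚ, shaAn W = (q : ℂ) ∧ padicValRat p q = 0) :
    MazurMainConjecture W p ∧ BSDp W p := by
  obtain ⟨hbsd, hMC⟩ := X1.bsdp_and_mainConjecture_of_rank_one_of_shaAn_unit hW16 hS hPR hmod hGZK W p
    hX1 hp hr1 hSch hunit
  exact ⟨hMC, hbsd⟩

/-- **Class level, `r_an = 1`, `p ≥ 5`, modulo the certificate: "Mazur's main conjecture at every such X1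
pair" ⟺ "`BSD(E,p)` at every such X1 pair"** (same published facts) — the rank-one counterpart of
`mazurMainConjectureOnX1_rankZero_iff`. [cite: Wuthrich2014, Thm. 16 and §6] [cite: PerrinRiou1987, §1.4 Cor. 1.8] -/
theorem forall_mazurMainConjecture_iff_forall_bsdp_of_analyticRank_eq_one
    (hW16 : Wuthrich2014.charIdeal_dvd_padicLFunction) (hS : Schneider1985_order_charGenerator)
    (hPR : perrinRiou_rankOne_leadingTerms) (hmod : nonempty_modularParametrizationData)
    (hGZK : rank_eq_analyticRank_of_analyticRank_le_one) :
    (∀ (W : WeierstrassCurve ℚ) [W.IsElliptic] [W.IsGloballyMinimal] (p : ℕ) [Fact p.Prime],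
        ClassX1 W p → 5 ≤ p → W.analyticRank = 1 →
        (∀ Dh : PAdicHeightData W p, Dh.IsCanonical → SchneiderConjecture Dh) →
        MazurMainConjecture W p) ↔
    (∀ (W : WeierstrassCurve ℚ) [W.IsElliptic] [W.IsGloballyMinimal] (p : ℕ) [Fact p.Prime],
        ClassX1 W p → 5 ≤ p → W.analyticRank = 1 →
        (∀ Dh : PAdicHeightData W p, Dh.IsCanonical → SchneiderConjecture Dh) → BSDp W p) := by
  constructor
  · intro h W _ _ p _ hX1 hp hr1 hSch
    exact (mazurMainConjecture_iff_bsdp_of_analyticRank_eq_one hW16 hS hPR hmod hGZK W p hX1 hp hr1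
      hSch).mp (h W p hX1 hp hr1 hSch)
  · intro h W _ _ p _ hX1 hp hr1 hSch
    exact (mazurMainConjecture_iff_bsdp_of_analyticRank_eq_one hW16 hS hPR hmod hGZK W p hX1 hp hr1
      hSch).mpr (h W p hX1 hp hr1 hSch)

end Summit.BirchSwinnertonDyer.BirchSwinnertonDyer.Theorems.Rank1ResidualX1RankOne

end
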